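import Summits.QuantumAdvantage.QuantumAdvantage.Theses.ArithStatLadder
import Summits.QuantumAdvantage.QuantumAdvantage.Theorems.ArithStatLadderIqThreeMemBQPStubMirrorDichotomy
import Summits.QuantumAdvantage.QuantumAdvantage.Theorems.ArithStatLadderIqThreeMemBQPStubFrontEnd
import Summits.QuantumAdvantage.QuantumAdvantage.Theorems.ArithStatLadderIqThreeMemBQPStubThreeOrdBit
import Summits.QuantumAdvantage.QuantumAdvantage.Theorems.ArithStatLadderIqThreeMemBQPStubImagWitnessOfBit
import Summits.QuantumAdvantage.QuantumAdvantage.Theorems.ArithStatLadderIqThreeMemBQPStubRedIdealsPerClass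
import Summits.QuantumAdvantage.QuantumAdvantage.Theorems.ArithStatLadderIqThreeMemBQPStubRealWitnessOfParts
import Summits.QuantumAdvantage.QuantumAdvantage.Theorems.ArithStatLadderIqThreeMemBQPStubGuardedOr
import Literature.Computability.Cryptography.HallgrenClassGroup
import Literature.Computability.Cryptography.HallgrenClassGroupAssembly
import Literature.Computability.Cryptography.HallgrenRealClassOrder
import Literature.NumberTheory.QuadraticFields.ThreeTorsion
import Literature.NumberTheory.QuadraticFields.ScholzHeckeUnitCriterion
import Literature.NumberTheory.QuadraticFields.ScholzHeckeUnitCriterionProofs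
import Literature.NumberTheory.QuadraticFields.ScholzHeckeUnitCriterionHolds
import Summits.QuantumAdvantage.QuantumAdvantage.Theorems.ArithStatLadderAvgFaceBeyondPriorMirrorTorsionImpThreeDvd

/-!
# `ArithStatLadder.IqThreeMemBQP` (stmt-QuantumAdvantage-2424) — the mirror triple test, assembled
# (line `scholz-mirror-siegel`; conditional on exactly one named fact, Hallgren 2007 `k = 1`)

Crux: `IQ3 = bin {d : −d fundamental, 3 ∣ h(−d)} ∈ BQP` unconditionally (no GRH). This file composes the seven
LANDED stubs of the line (`Theorems/ArithStatLadderIqThreeMemBQPStub*.lean`: S1 `stub_mirrorDichotomy` — a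
quadratic field and its Scholz mirror are never both dark (Landau repulsion + MV 11.14 case A, effective); S3
`stub_frontEnd` — the guard `FUND ∈ BQP` and the unit-cube promise problem; S4a `stub_threeOrdBit` + S4b
`stub_imagWitnessOfBit` — the imaginary torsion-witness sampler over the tree's PROVED Hallgren/Kitaev
subgroup-order algorithm `Hallgren2005.subgroupOrder_qsolvable_holds`; S6a `stub_redIdealsPerClass` + S6b
`stub_realWitnessOfParts` — the real torsion-witness sampler on the mirror field (reduced-ideal sampler); S7
`stub_guardedOr` — the generic guarded-OR closure of `BQP`) into the crux, together with four TREE THEOREMS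
(`Hallgren2005.subgroupOrder_qsolvable_holds` — the imaginary subgroup-order algorithm; `ScholzHecke.cube_imp_three_dvd`
and `ScholzHecke.three_dvd_imp_cube` — both directions of the Scholz–Hecke unit criterion, class field theory of the
mirror pair, PROVED in the tree 2026-08-16; `AvgFaceBeyondPrior.Mirror.stub_mirrorTorsionImpThreeDvd` — the rank-one
shadow `#Cl₃(D⁺) ≠ 1 → 3 ∣ h(−d)` of Scholz's left inequality, landed by the lead of crux stmt-QuantumAdvantage-2427),
CONDITIONALLY on exactly ONE published fact that the tree states but does not yet prove:

* `Hallgren2007_idealClassOrder_qsolvable` — the order of ONE ideal class of a real quadratic field in quantum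
  polynomial time, GRH-free (the real-side order primitive S5 of the line, verbatim; Hallgren 2002/2007, the `k = 1`
  generator-free case of the real-quadratic class-group algorithm; Childs–van Dam 2010 §5.7).

`IqThreeMemBQP_of_facts : Hallgren2007_idealClassOrder_qsolvable → IqThreeMemBQP`; the day
`Hallgren2007_idealClassOrder_qsolvable_holds` lands the crux closes by one line. The arithmetic of the composition (`iqThree_mem_BQP_of_parts`, def-free): outside the finite table
`d < max d₀ 4` — YES side: `d ∈ IQ3`, not a T1-cube ⇒ (Scholz–Hecke (ii)) `#Cl₃(D⁺) ≠ 1` ⇒ (S1) `d` is a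
yes-instance of the imaginary or of the real witness problem; NO side: `3 ∤ h(−d)` ⇒ (rank-one Scholz left)
`#Cl₃(D⁺) = 1` and (Scholz–Hecke (i)) not a cube; non-fundamental inputs are rejected by the guard.
-/

noncomputable section

open scoped NumberField nonZeroDivisors

namespace Summit.QuantumAdvantage.QuantumAdvantage.Theorems.ArithStatLadder.IqThreeMemBQP

open _root_.Computability Literature.Computability.Complexity Literature.Computability.Cryptography
open Literature.Computability.QuantumComplexity
open Literature.NumberTheory.QuadraticFields

/-! ## The arithmetic of the mirror triple test -/

/-- A code word outside the exception table `bin [0, d₁)` encodes a number `≥ d₁`. -/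
theorem le_of_not_mem_table' {d₁ d : ℕ}
    (h : encodingNatBool.encode d ∉ (Finset.range d₁).image encodingNatBool.encode) : d₁ ≤ d := by
  by_contra hlt
  exact h (Finset.mem_image.2 ⟨d, Finset.mem_range.2 (not_le.mp hlt), rfl⟩)

/-- **The composition over the stub statements** (def-free; kernel-checked): the guard `FUND`, the unit-cube
promise problem and the two torsion-witness promise problems at the dichotomy's brightness constant cover `IQ3`
and its complement outside the finite table `d < max d₀ 4`; direction (i) of the Scholz–Hecke criterion enters as
the tree theorem `ScholzHecke.cube_imp_three_dvd`. -/
theorem iqThree_mem_BQP_of_parts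
    (h1 : ∃ c : ℝ, 0 < c ∧ ∃ d₀ : ℕ, ∀ d : ℕ, d₀ ≤ d → IsNegFundamentalDiscr d → (∀ (K : Type) [Field K] [NumberField K], Module.finrank ℚ K = 2 →
          NumberField.discr K = -(d : ℤ) → c / Real.log d ≤ NumberField.dedekindZeta_residue K) ∨
        (∀ (F : Type) [Field F] [NumberField F], Module.finrank ℚ F = 2 →
          NumberField.discr F = (if 3 ∣ d then ((d / 3 : ℕ) : ℤ) else 3 * (d : ℤ)) →
            c / Real.log d ≤ NumberField.dedekindZeta_residue F))
    (h2a : ∀ d : ℕ, IsNegFundamentalDiscr d → quadFieldThreeTorsion (if 3 ∣ d then ((d / 3 : ℕ) : ℤ) else 3 * (d : ℤ)) ≠ 1 →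
        3 ∣ BinaryQuadraticForm.classNumber (-(d : ℤ)))
    (h2 : ∀ d : ℕ, IsNegFundamentalDiscr d → d ≠ 3 → quadFieldThreeTorsion (if 3 ∣ d then ((d / 3 : ℕ) : ℤ) else 3 * (d : ℤ)) = 1 →
        3 ∣ BinaryQuadraticForm.classNumber (-(d : ℤ)) → UnitCubeAtThree d)
    (h3 : encodingNatBool.toLanguage {d : ℕ | IsNegFundamentalDiscr d} ∈ BQP ∧
      (⟨encodingNatBool.toLanguage {d : ℕ | IsNegFundamentalDiscr d ∧ d ≠ 3 ∧ UnitCubeAtThree d},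
        encodingNatBool.toLanguage {d : ℕ | IsNegFundamentalDiscr d ∧ d ≠ 3 ∧ ¬ UnitCubeAtThree d}⟩ :
          PromiseProblem) ∈ PromiseBQP)
    (h4 : ∀ c : ℝ, 0 < c →
      (⟨encodingNatBool.toLanguage {d : ℕ | IsNegFundamentalDiscr d ∧
          3 ∣ BinaryQuadraticForm.classNumber (-(d : ℤ)) ∧
          ∀ (K : Type) [Field K] [NumberField K], Module.finrank ℚ K = 2 →
            NumberField.discr K = -(d : ℤ) → c / Real.log d ≤ NumberField.dedekindZeta_residue K},
        encodingNatBool.toLanguage {d : ℕ | IsNegFundamentalDiscr d ∧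
          ¬ 3 ∣ BinaryQuadraticForm.classNumber (-(d : ℤ))}⟩ : PromiseProblem) ∈ PromiseBQP)
    (h6 : ∀ c : ℝ, 0 < c →
      (⟨encodingNatBool.toLanguage {d : ℕ | IsNegFundamentalDiscr d ∧ d ≠ 3 ∧
          quadFieldThreeTorsion (if 3 ∣ d then ((d / 3 : ℕ) : ℤ) else 3 * (d : ℤ)) ≠ 1 ∧
          ∀ (F : Type) [Field F] [NumberField F], Module.finrank ℚ F = 2 →
            NumberField.discr F = (if 3 ∣ d then ((d / 3 : ℕ) : ℤ) else 3 * (d : ℤ)) →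
              c / Real.log d ≤ NumberField.dedekindZeta_residue F},
        encodingNatBool.toLanguage {d : ℕ | IsNegFundamentalDiscr d ∧ d ≠ 3 ∧
          quadFieldThreeTorsion (if 3 ∣ d then ((d / 3 : ℕ) : ℤ) else 3 * (d : ℤ)) = 1}⟩ : PromiseProblem) ∈
        PromiseBQP)
    (h7 : ∀ (L G : Language Bool) (Q₁ Q₂ Q₃ : PromiseProblem) (E : Finset (List Bool)),
        G ∈ BQP → Q₁ ∈ PromiseBQP → Q₂ ∈ PromiseBQP → Q₃ ∈ PromiseBQP →
        (∀ w, w ∉ E → w ∈ L → w ∈ G ∧ (w ∈ Q₁.yes ∨ w ∈ Q₂.yes ∨ w ∈ Q₃.yes)) →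
        (∀ w, w ∉ E → w ∉ L → w ∉ G ∨ (w ∈ Q₁.no ∧ w ∈ Q₂.no ∧ w ∈ Q₃.no)) →
          L ∈ BQP) :
    encodingNatBool.toLanguage
      {d : ℕ | IsNegFundamentalDiscr d ∧ 3 ∣ BinaryQuadraticForm.classNumber (-(d : ℤ))} ∈ BQP := by
  obtain ⟨c, hc, d₀, hdich⟩ := h1
  refine h7 _ _ _ _ _ ((Finset.range (max d₀ 4)).image encodingNatBool.encode) h3.1 h3.2 (h4 c hc)
    (h6 c hc) ?_ ?_
  · -- YES side: members of `IQ3` outside the table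
    intro w hwE hwL
    obtain ⟨d, hdS, rfl⟩ := hwL
    obtain ⟨hfund, h3dvd⟩ := hdS
    have hd₁ : max d₀ 4 ≤ d := le_of_not_mem_table' hwE
    have hd₀ : d₀ ≤ d := le_trans (le_max_left _ _) hd₁
    have hd3 : d ≠ 3 := by
      have : 4 ≤ d := le_trans (le_max_right _ _) hd₁
      omega
    refine ⟨(encodingNatBool.mem_toLanguage_iff _ d).2 hfund, ?_⟩
    by_cases hprim : UnitCubeAtThree d
    · exact Or.inl ((encodingNatBool.mem_toLanguage_iff _ d).2 ⟨hfund, hd3, hprim⟩)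
    · right
      have hrF : quadFieldThreeTorsion (if 3 ∣ d then ((d / 3 : ℕ) : ℤ) else 3 * (d : ℤ)) ≠ 1 := fun h1' => hprim (h2 d hfund hd3 h1' h3dvd)
      rcases hdich d hd₀ hfund with hB | hB
      · exact Or.inl ((encodingNatBool.mem_toLanguage_iff _ d).2 ⟨hfund, h3dvd, hB⟩)
      · exact Or.inr ((encodingNatBool.mem_toLanguage_iff _ d).2 ⟨hfund, hd3, hrF, hB⟩)
  · -- NO side: non-members outside the table
    intro w hwE hwL
    by_cases hG : w ∈ encodingNatBool.toLanguage {d : ℕ | IsNegFundamentalDiscr d}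
    · right
      obtain ⟨d, hfund, rfl⟩ := hG
      have hd₁ : max d₀ 4 ≤ d := le_of_not_mem_table' hwE
      have hd3 : d ≠ 3 := by
        have : 4 ≤ d := le_trans (le_max_right _ _) hd₁
        omega
      have hndvd : ¬ 3 ∣ BinaryQuadraticForm.classNumber (-(d : ℤ)) := fun h3 =>
        hwL ((encodingNatBool.mem_toLanguage_iff _ d).2 ⟨hfund, h3⟩)
      refine ⟨?_, ?_, ?_⟩
      · -- `bin d ∈ cubeNo`: a cube unit would force `3 ∣ h(−d)` (Scholz–Hecke (i), tree theorem)
        exact (encodingNatBool.mem_toLanguage_iff _ d).2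
          ⟨hfund, hd3, fun hp => hndvd (ScholzHecke.cube_imp_three_dvd hfund hd3 hp)⟩
      · exact (encodingNatBool.mem_toLanguage_iff _ d).2 ⟨hfund, hndvd⟩
      · -- `bin d ∈ noPos`: mirror `3`-torsion would force `3 ∣ h(−d)` (rank-one Scholz left)
        refine (encodingNatBool.mem_toLanguage_iff _ d).2 ⟨hfund, hd3, ?_⟩
        by_contra hne
        exact hndvd (h2a d hfund hne)
    · exact Or.inl hG

/-- **The crux `ArithStatLadder.IqThreeMemBQP` (stmt-QuantumAdvantage-2424), conditionally on the one named fact**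
`Hallgren2007_idealClassOrder_qsolvable` (the GRH-free order of one real ideal class, Hallgren 2007 `k = 1`):
composition of the seven landed stubs of line `scholz-mirror-siegel` with the tree theorems
`Hallgren2005.subgroupOrder_qsolvable_holds`, `ScholzHecke.cube_imp_three_dvd`, `ScholzHecke.three_dvd_imp_cube` and
`AvgFaceBeyondPrior.Mirror.stub_mirrorTorsionImpThreeDvd`. -/
theorem IqThreeMemBQP_of_facts (hH : Hallgren2007_idealClassOrder_qsolvable) :
    Summit.QuantumAdvantage.QuantumAdvantage.Theses.ArithStatLadder.IqThreeMemBQP :=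
  iqThree_mem_BQP_of_parts stub_mirrorDichotomy
    (fun d hd => Summit.QuantumAdvantage.QuantumAdvantage.Theorems.AvgFaceBeyondPrior.Mirror.stub_mirrorTorsionImpThreeDvd
      d hd)
    (fun _ hd h3 => ScholzHecke.three_dvd_imp_cube hd h3) stub_frontEnd
    (stub_imagWitnessOfBit (stub_threeOrdBit Hallgren2005.subgroupOrder_qsolvable_holds))
    (stub_realWitnessOfParts stub_redIdealsPerClass hH) stub_guardedOr

end Summit.QuantumAdvantage.QuantumAdvantage.Theorems.ArithStatLadder.IqThreeMemBQP

end
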